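import Mathlib.Algebra.MonoidAlgebra.Basic
import Mathlib.Algebra.GCDMonoid.Finset
import Mathlib.Algebra.GCDMonoid.Nat
import Mathlib.Analysis.Convex.Hull
import Mathlib.Analysis.Convex.Extreme
import Mathlib.Analysis.Convex.Topology
import HarnessLib

/-!
# Mutations of Laurent polynomials; maximally mutable and rigid Laurent polynomials (CKPT)

Vocabulary of the Fanosearch programme for Laurent polynomials `f ∈ ℚ[N]`, `N = ℤⁿ`
(`AddMonoidAlgebra ℚ (Fin n → ℤ)`), following

* T. Coates, A. M. Kasprzyk, G. Pitton, K. Tveiten, *Maximally mutable Laurent polynomials*,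
  Proc. R. Soc. A 477 (2021) 20210584 = arXiv:2107.14253 [CoatesKasprzykPittonTveiten2021],
  §1.1 Def. 1.1 (Fano polytope), §1.5 Def. 1.6 (mutation `μ_{w,a}`, mutability, factor),
  §2 Def. 2.2 (normalised), Convention 2.3, Def. 2.4–2.6 (mutation graph, MMLP, rigid) and the
  local characterisation (2.1) `L_{Newt f}(S_f) = {f}`;
* M. Akhtar, T. Coates, S. Galkin, A. M. Kasprzyk, *Minkowski polynomials and mutations*,
  SIGMA 8 (2012) 094 = arXiv:1212.1785, §2 Def. 2 [AkhtarCoatesGalkinKasprzyk2012].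

## Contents

* `pair w v = Σᵢ wᵢ vᵢ` (the pairing `M × N → ℤ`), `IsPrimitive w` (gcd of the entries is `1`),
  `gradedPiece w i f` (the `w`-degree-`i` part of `f`), `InHyperplane w a` (`a ∈ ℚ[w^⊥ ∩ N]`);
* `IsMutableWith w a f` — Def. 1.6: `μ_{w,a}(f) = Σ_v c_v x^v a^{w(v)}` is again a Laurent
  polynomial, in the printed divisibility form "for each `i < 0` there is `r_i` with
  `P_i = r_i a^{|i|}`" (§1.5), i.e. `a^{-i} ∣ f_i` in `ℚ[N]` for every `i < 0`;
  `IsMutation w a f g` — `g = μ_{w,a}(f)`, relationally on graded pieces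
  (`g_i · a^{-i} = f_i` for `i < 0`, `g_i = f_i · a^{i}` for `i ≥ 0`);
* `newtonPolytope f = conv(supp f) ⊂ ℝⁿ`, `IsFanoPolytope` (Def. 1.1), `IsNormalised` (Def. 2.2),
  `HasNatCoeffs`, `GeneratesLattice` (Convention 2.3 and the standing convention that the
  exponents generate `N`);
* `mutationData f = S_f`, `compatible P S = L_P(S)`, **`IsLocallyRigidMMLP`** (all `n`) and
  **`IsRigidMMLP`** (two variables).

## Which definition of "rigid MMLP" (read this)

CKPT define the *mutation graph* `Γ_f` (Def. 2.4: an infinite labelled graph grown from `f` by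
iterated mutation, vertices relabelled by `GL(N)`-classes of Newton polytopes, edges by the data
`L(w,a)` up to `w`-shears), call `f` *maximally mutable* if `Newt f` is Fano, the constant term of
`f` is `0` and `Γ_f` is maximal for the order "label-preserving injection" (Def. 2.5), and call an
MMLP *rigid* if it is the only `g` with zero constant term and `Newt g = Newt f` having
`Γ_g = Γ_f` (Def. 2.6). They then give the LOCAL characterisation [CKPT, §2, (2.1) and the two
sentences around it]: with `S_f = {(w,a) : f is mutable w.r.t. (w,a)}` and
`L_P(S) = {g : Newt g = P, g mutable w.r.t. every (w,a) ∈ S}` (all Laurent polynomials and factors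
normalised with non-negative integer coefficients, Convention 2.3; constant terms zero, Def. 2.5
and Remark 2.7), "`f` is a rigid MMLP if and only if `L_{Newt f}(S_f) = {f}`" — stated for two
variables ("In dimension two … rigidity of `f` can be detected 'locally'") with "We expect (2.1)
to characterise rigid MMLPs in all dimensions."

This file formalises the local characterisation (2.1), together with the side conditions of
Def. 2.5 (`Newt f` Fano, zero constant term) and Convention 2.3, as `IsLocallyRigidMMLP` in every
number of variables `n`, and defines `IsRigidMMLP` ONLY IN TWO VARIABLES, as `IsLocallyRigidMMLP`
on `ℚ[ℤ²]` — where CKPT state that it IS their notion of rigid MMLP (the case of Thm. 3.10/3.12 and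
of the conjecture on p. 11 used by route KontsevichZagierPeriods/MarkovTreeOfMoves). For `n ≥ 3`
the printed Def. 2.4–2.6 (mutation graph) is a different predicate a priori, only EXPECTED by CKPT
to agree with `IsLocallyRigidMMLP`; consumers of CKPT's higher-dimensional statements (e.g.
Thm. 4.1) must either formalise the mutation graph or carry that expected equivalence as an
explicit hypothesis. The mutation graph itself is not formalised here.

## Design notes

* Mutability as divisibility in the domain `ℚ[N]`: if `f_i = x^{v} p` with `w(v) = i` and
  `p, a ∈ ℚ[w^⊥ ∩ N]`, then `a^k ∣ f_i` in `ℚ[N] ≅ ℚ[w^⊥ ∩ N][y^{±1}]` iff `a^k ∣ p` in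
  `ℚ[w^⊥ ∩ N]` (compare `y`-degrees), which is the printed condition.
* Factors are taken normalised with non-negative integer coefficients (Convention 2.3); monomial
  ("trivial") factors impose no condition (`isMutableWith_of_isUnit`), so including them in `S_f`
  is harmless.
* `newtonPolytope` lives in `ℝⁿ` (Mathlib `convexHull`, `Set.extremePoints`, `interior`); "maximal
  dimension" + "origin in the interior" of Def. 1.1 is `0 ∈ interior (Newt f)`.
* Mathlib has no Newton polytopes of Laurent polynomials or mutations (searched `newtonPolytope`,
  `Mutation`); `AddMonoidAlgebra`, `Finsupp.filter`, `Finset.gcd`, `convexHull`,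
  `Set.extremePoints` are Mathlib's.

## What is NOT here

`IsMutationEquivalent` (composites of `GL_n(ℤ)` monomial maps and mutations; a separate
definition item), the mutation graph `Γ_f` and the order of Def. 2.5, mutation of polytopes
(Def. 1.8), classical periods `π_f`, and any of CKPT's theorems (Prop. 3.8 "pro:MMLP",
Thm. 3.10, 3.12, 4.1).
-/

noncomputable section

open Finset

namespace Literature.AlgebraicGeometry.Mutations

/-- Laurent polynomials over `ℚ` in `n` variables: the group algebra `ℚ[N]` of the lattice
`N = ℤⁿ` (monomials `x^v`, `v ∈ ℤⁿ`). [cite: CoatesKasprzykPittonTveiten2021, §1.1 (ℂ[N], here over ℚ as in §2)] -/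
abbrev Laurent (n : ℕ) : Type := AddMonoidAlgebra ℚ (Fin n → ℤ)

variable {n : ℕ}

/-! ### Gradings by dual vectors -/

/-- The pairing `w(v) = Σᵢ wᵢ vᵢ` of a dual vector `w ∈ M = Hom(N, ℤ) ≅ ℤⁿ` with `v ∈ N = ℤⁿ`.
[cite: CoatesKasprzykPittonTveiten2021, Def. 1.6] -/
def pair (w v : Fin n → ℤ) : ℤ := ∑ i, w i * v i

/-- `w ∈ M` is **primitive**: the gcd of its coordinates is `1` (so `w ≠ 0` and `w` is not a proper
multiple of a lattice vector). [cite: CoatesKasprzykPittonTveiten2021, Def. 1.6 ("primitive vector in the dual lattice")] -/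
def IsPrimitive (w : Fin n → ℤ) : Prop := (univ : Finset (Fin n)).gcd w = 1

/-- The `w`-graded piece of degree `i` of `f`: the sum of the terms `c_v x^v` of `f` with
`w(v) = i` ("`w` induces a grading on `ℚ[N]`"). [cite: CoatesKasprzykPittonTveiten2021, Def. 1.6] -/
def gradedPiece (w : Fin n → ℤ) (i : ℤ) (f : Laurent n) : Laurent n :=
  .ofCoeff (Finsupp.filter (fun v => pair w v = i) f.coeff)

/-- `a ∈ ℚ[w^⊥ ∩ N]`: every exponent of `a` lies in the hyperplane `w(v) = 0` (the zeroth graded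
piece). [cite: CoatesKasprzykPittonTveiten2021, Def. 1.6] -/
def InHyperplane (w : Fin n → ℤ) (a : Laurent n) : Prop := ∀ v ∈ a.coeff.support, pair w v = 0

/-! ### Mutations (Def. 1.6) -/

/-- **Mutability** (CKPT Def. 1.6, in the divisibility form of §1.5): `f` is mutable with respect
to the mutation data `(w, a)`, `a ∈ ℚ[w^⊥ ∩ N]`, if `μ_{w,a}(f) = Σ_v c_v x^v a^{w(v)}` is a Laurent
polynomial, i.e. iff for every `i < 0` the graded piece `f_i` is divisible by `a^{-i}` in `ℚ[N]`
("for each `i ∈ ℤ_{<0}` there exists `r_i` such that `P_i = r_i a^{|i|}`").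
[cite: CoatesKasprzykPittonTveiten2021, Def. 1.6 and §1.5] -/
def IsMutableWith (w : Fin n → ℤ) (a f : Laurent n) : Prop :=
  ∀ i : ℤ, i < 0 → a ^ (-i).toNat ∣ gradedPiece w i f

/-- **`g` is the mutation `μ_{w,a}(f)`** (CKPT Def. 1.6: `x^v ↦ x^v a^{w(v)}`), stated on graded
pieces without division: `g_i · a^{-i} = f_i` for `i < 0` and `g_i = f_i · a^{i}` for `i ≥ 0`.
When `f` is mutable with respect to `(w, a)` and `a ≠ 0` this determines `g` uniquely (`ℚ[N]` is
a domain). [cite: CoatesKasprzykPittonTveiten2021, Def. 1.6 and §1.5 (formula for g = μ(f))] -/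
def IsMutation (w : Fin n → ℤ) (a f g : Laurent n) : Prop :=
  ∀ i : ℤ, (i < 0 → gradedPiece w i g * a ^ (-i).toNat = gradedPiece w i f) ∧
    (0 ≤ i → gradedPiece w i g = gradedPiece w i f * a ^ i.toNat)

/-- A unit factor (e.g. a monomial `x^b`, `b ∈ w^⊥ ∩ N`: a "trivial" mutation, a monomial change
of basis) imposes no mutability condition. [cite: CoatesKasprzykPittonTveiten2021, Def. 1.6 (trivial mutations)] -/
theorem isMutableWith_of_isUnit {w : Fin n → ℤ} {a : Laurent n} (ha : IsUnit a) (f : Laurent n) :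
    IsMutableWith w a f :=
  fun _ _ => (ha.pow _).dvd

/-- The identity is the mutation with factor `1`. [folklore] -/
theorem isMutation_one_self (w : Fin n → ℤ) (f : Laurent n) : IsMutation w 1 f f :=
  fun _ => ⟨fun _ => by rw [one_pow, mul_one], fun _ => by rw [one_pow, mul_one]⟩

/-! ### Newton polytopes, normalisation, Fano polytopes -/

/-- A lattice point of `N = ℤⁿ` as a point of `N_ℝ = ℝⁿ`. [folklore] -/
def latticePoint (v : Fin n → ℤ) : Fin n → ℝ := fun i => (v i : ℝ)

/-- The **Newton polytope** `Newt f = conv{v : c_v ≠ 0} ⊂ N_ℝ` of a Laurent polynomial.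
[cite: CoatesKasprzykPittonTveiten2021, §1.6 ("the Newton polytope of a Laurent polynomial f")] -/
def newtonPolytope (f : Laurent n) : Set (Fin n → ℝ) :=
  convexHull ℝ (latticePoint '' (f.coeff.support : Set (Fin n → ℤ)))

/-- A convex lattice polytope `P ⊂ N_ℝ` is **Fano** (CKPT Def. 1.1): it has maximal dimension and
contains the origin in its interior (together: `0 ∈ interior P`), and its vertices are primitive
lattice points. [cite: CoatesKasprzykPittonTveiten2021, Def. 1.1] -/
def IsFanoPolytope (P : Set (Fin n → ℝ)) : Prop :=
  (0 : Fin n → ℝ) ∈ interior P ∧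
    ∀ x ∈ P.extremePoints ℝ, ∃ v : Fin n → ℤ, IsPrimitive v ∧ latticePoint v = x

/-- `f` is **normalised** (CKPT Def. 2.2): the coefficient of `x^v` is `1` for every vertex `v` of
`Newt f`. [cite: CoatesKasprzykPittonTveiten2021, Def. 2.2] -/
def IsNormalised (f : Laurent n) : Prop :=
  ∀ v ∈ f.coeff.support, latticePoint v ∈ (newtonPolytope f).extremePoints ℝ → f.coeff v = 1

/-- All coefficients are non-negative integers (CKPT Convention 2.3, imposed on all Laurent
polynomials and all mutation factors from §2 on). [cite: CoatesKasprzykPittonTveiten2021, Convention 2.3] -/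
def HasNatCoeffs (f : Laurent n) : Prop := ∀ v : Fin n → ℤ, ∃ m : ℕ, f.coeff v = m

/-- The exponents of `f` generate the lattice `N` (CKPT's standing convention, recalled in
Convention 2.3; assumption (iii) of §1.1). [cite: CoatesKasprzykPittonTveiten2021, Convention 2.3 and §1.1 (iii)] -/
def GeneratesLattice (f : Laurent n) : Prop :=
  AddSubgroup.closure (f.coeff.support : Set (Fin n → ℤ)) = ⊤

/-! ### Rigid maximally mutable Laurent polynomials -/

/-- `S_f`: the set of (normalised, Convention 2.3) mutation data `(w, a)` — `w` primitive,
`a ∈ ℚ[w^⊥ ∩ N]` normalised with non-negative integer coefficients — with respect to which `f` is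
mutable. [cite: CoatesKasprzykPittonTveiten2021, §2 (definition of S_f before (2.1))] -/
def mutationData (f : Laurent n) : Set ((Fin n → ℤ) × Laurent n) :=
  {p | IsPrimitive p.1 ∧ InHyperplane p.1 p.2 ∧ IsNormalised p.2 ∧ HasNatCoeffs p.2 ∧
    IsMutableWith p.1 p.2 f}

/-- `L_P(S)`: the Laurent polynomials with Newton polytope `P` that are mutable with respect to
every datum in `S` — among the Laurent polynomials of §2, i.e. normalised, with non-negative
integer coefficients, exponents generating `N` (Convention 2.3) and zero constant term (Def. 2.5,
Remark 2.7: constant terms are invisible to mutation, and MMLPs have constant term `0`).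
[cite: CoatesKasprzykPittonTveiten2021, §2 (definition of L_P(S) before (2.1)), Convention 2.3, Def. 2.5] -/
def compatible (P : Set (Fin n → ℝ)) (S : Set ((Fin n → ℤ) × Laurent n)) : Set (Laurent n) :=
  {g | IsNormalised g ∧ HasNatCoeffs g ∧ GeneratesLattice g ∧ g.coeff 0 = 0 ∧ newtonPolytope g = P ∧
    ∀ p ∈ S, IsMutableWith p.1 p.2 g}

/-- **Locally rigid MMLP** — CKPT's local characterisation (2.1) of rigid maximally mutable
Laurent polynomials, with the side conditions of Def. 2.5: `Newt f` is a Fano polytope and `f` is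
the ONLY Laurent polynomial of §2 (normalised, non-negative integer coefficients, exponents
generating `N`, zero constant term) with Newton polytope `Newt f` that is mutable with respect to
every mutation datum of `f`: `L_{Newt f}(S_f) = {f}`. CKPT (§2, after Remark 2.7): "`f` is a rigid
MMLP if and only if `L_{Newt f}(S_f) = {f}`" in two variables, and "We expect (2.1) to
characterise rigid MMLPs in all dimensions" — so for `n ≥ 3` agreement with the printed
Def. 2.4–2.6 (via the mutation graph, not formalised here) is CKPT's expectation, not a theorem;
see `IsRigidMMLP` for the two-variable notion. [cite: CoatesKasprzykPittonTveiten2021, §2 (2.1) with Def. 2.5 (side conditions)] -/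
def IsLocallyRigidMMLP (f : Laurent n) : Prop :=
  IsFanoPolytope (newtonPolytope f) ∧ compatible (newtonPolytope f) (mutationData f) = {f}

/-- **Rigid maximally mutable Laurent polynomial in two variables** (CKPT Def. 2.5–2.6): by CKPT,
§2 ("In dimension two … rigidity of `f` can be detected 'locally' … Then `f` is a rigid MMLP if and
only if (2.1)"), for `f ∈ ℚ[ℤ²]` the printed notion (Fano Newton polygon, zero constant term,
maximal mutation graph, uniqueness among `g` with the same Newton polygon and mutation graph)
coincides with the local one, which we take as its Lean form: `IsRigidMMLP f := IsLocallyRigidMMLP f`.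
Deliberately NOT defined for `n ≥ 3` variables (see `IsLocallyRigidMMLP` and the module docstring).
[cite: CoatesKasprzykPittonTveiten2021, Def. 2.5–2.6 and §2 (2.1) (two variables)] -/
def IsRigidMMLP (f : Laurent 2) : Prop := IsLocallyRigidMMLP f

/-- Unfolding: in two variables, rigid MMLP = locally rigid MMLP (by definition here; by CKPT §2 in
print). [cite: CoatesKasprzykPittonTveiten2021, §2 (2.1)] -/
theorem isRigidMMLP_iff (f : Laurent 2) : IsRigidMMLP f ↔ IsLocallyRigidMMLP f := Iff.rfl

/-- A locally rigid MMLP belongs to its own compatible set: it is normalised, has non-negative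
integer coefficients, its exponents generate `N`, and its constant term vanishes. [folklore] -/
theorem IsLocallyRigidMMLP.mem_compatible {f : Laurent n} (h : IsLocallyRigidMMLP f) :
    f ∈ compatible (newtonPolytope f) (mutationData f) := by
  rw [h.2]
  exact Set.mem_singleton f

/-- In particular a locally rigid MMLP has zero constant term. [cite: CoatesKasprzykPittonTveiten2021, Def. 2.5] -/
theorem IsLocallyRigidMMLP.coeff_zero {f : Laurent n} (h : IsLocallyRigidMMLP f) : f.coeff 0 = 0 :=
  h.mem_compatible.2.2.2.1

/-- … and is normalised. [cite: CoatesKasprzykPittonTveiten2021, Def. 2.2 and Convention 2.3] -/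
theorem IsLocallyRigidMMLP.isNormalised {f : Laurent n} (h : IsLocallyRigidMMLP f) :
    IsNormalised f :=
  h.mem_compatible.1

/-- Uniqueness clause: any Laurent polynomial of §2 with the same Newton polytope that admits all
mutations of a locally rigid MMLP `f` equals `f`. [cite: CoatesKasprzykPittonTveiten2021, (2.1)] -/
theorem IsLocallyRigidMMLP.eq_of_mem {f g : Laurent n} (h : IsLocallyRigidMMLP f)
    (hg : g ∈ compatible (newtonPolytope f) (mutationData f)) : g = f := by
  rw [h.2] at hg
  exact Set.mem_singleton_iff.mp hg

/-- A rigid MMLP in two variables has zero constant term. [cite: CoatesKasprzykPittonTveiten2021, Def. 2.5] -/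
theorem IsRigidMMLP.coeff_zero {f : Laurent 2} (h : IsRigidMMLP f) : f.coeff 0 = 0 :=
  IsLocallyRigidMMLP.coeff_zero h

/-- Uniqueness clause of rigidity in two variables. [cite: CoatesKasprzykPittonTveiten2021, Def. 2.6 and (2.1)] -/
theorem IsRigidMMLP.eq_of_mem {f g : Laurent 2} (h : IsRigidMMLP f)
    (hg : g ∈ compatible (newtonPolytope f) (mutationData f)) : g = f :=
  IsLocallyRigidMMLP.eq_of_mem h hg

end Literature.AlgebraicGeometry.Mutations

end
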